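import Summits.SmoothPoincare4.SmoothPoincare4.Theorems.CylinderEntropyCylinderRungTwoHamiltonMonotonicityIdentity
import Literature.Geometry.Riemannian.SphericalCylinderEntropyMatrixHarnack
import HarnessLib

/-!
# Hamilton's monotonicity of the typed density along a smooth cylinder flow
# (stub `stub_hamiltonMonotonicity`, line `killing-flux`)

Final part of the proof of the registered stub `stub_hamiltonMonotonicity` of line `killing-flux` of
the crux `CylinderEntropy.CylinderRungTwo` (stmt-SmoothPoincare4-7631): along a smooth mean
curvature flow `IsCylinderMCF M F ν T` (`CylinderEntropyCylinderRungTwoKillingFluxDefs.lean`) of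
closed embedded cross-sections of `N = S⁴ × ℝ ⊂ ℝ⁶`, for every centre `p ∈ N`, scale `τ > 0`, lag
`σ ≥ 0` and time `s ≥ T`, the typed slice-normalised Gaussian density satisfies
`F̂_{p,τ}(F_{s+σ}(M)) ≤ F̂_{p,τ+σ}(F_s(M))` — R. S. Hamilton, *Monotonicity formulas for parabolic
flows on manifolds*, Comm. Anal. Geom. 1 (1993) 127–137, Thm. 4.1 (`n - m = 1`), for the typed
density `cylDensity (range (F t)) p (t₀ - t) = (4π)^{1/2} (t₀ - t)^{1/2} ∫_{Σ_t} K_N(·, p; t₀ - t) dμ`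
(`K_N = H_{S⁴} ⊗ G_ℝ` the heat kernel of `N`; `cylKernel = vol(S⁴)(4πτ)^{1/2} K_N`).

* `IsCylinderMCF.harnackIntegral_nonneg` — the Harnack integral over a slice is `≥ 0`: Hamilton's
  matrix Harnack inequality for the heat kernel of `S⁴` transported to the typed kernel along `N`
  (`Literature/…/SphericalCylinderEntropyMatrixHarnack.lean`, `harnackQuadratic_nonneg`);
* `IsCylinderMCF.cylDensity_le` — with `t₀ = s + σ + τ`, `Z(t) = F̂_{p,t₀-t}(F_t(M))` is continuous
  on `[s, s+σ]` and `Z' = -D - c∫Q ≤ 0` inside (the monotonicity FORMULA of part 6,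
  `IsCylinderMCF.hasDerivAt_cylDensity`, and right-continuity at `T`), hence non-increasing
  (`antitoneOn_of_hasDerivWithinAt_nonpos`); finiteness of the densities of compact embedded slices
  (`cylDensity_range_lt_top`) transfers the inequality to `ℝ≥0∞`;
* `stub_hamiltonMonotonicity` — the registered signature, verbatim.

The chain of this stub: part 1 `…Transport.lean` (transport formula along the flow), part 2
`…Frame.lean` + part 3 `…Divergence.lean` (Green identity `∫_Σ Δ_Σ(k|_Σ) = 0` in ambient terms, via
`Literature/Geometry/Lorentzian/HypersurfaceHessianCodimTwo.lean`), part 4 `…KernelFlow.lean`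
(the typed kernel along the flow, Hamilton's pointwise identity), part 5 `…Density.lean` (area
formula, right-continuity), part 6 `…Identity.lean` (the monotonicity formula); the analytic inputs
(joint smoothness, backward heat equation and positivity of the typed kernel, matrix Harnack) are
the tree's `Literature/Geometry/Riemannian/SphericalCylinderEntropy*.lean`.
Everything is PROVED (no `sorry`, no new definitions, no named facts). Test case: for the static
slice (`isCylinderMCF_staticSlice`) both sides are `e^{-(c-p₅)²/4τ} ≤ e^{-(c-p₅)²/4(τ+σ)}`.

References: R. S. Hamilton, Comm. Anal. Geom. 1 (1993) 127–137, Thm. 4.1; R. S. Hamilton, *A matrix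
Harnack estimate for the heat equation*, Comm. Anal. Geom. 1 (1993) 113–126.
-/

-- the prescribed namespace `Summit.SmoothPoincare4.SmoothPoincare4.…` repeats `SmoothPoincare4`
set_option linter.dupNamespace false

noncomputable section

open Bundle MeasureTheory Set Function Filter Module
open scoped Manifold ContDiff ENNReal Topology RealInnerProductSpace NNReal Matrix BigOperators

namespace Summit.SmoothPoincare4.SmoothPoincare4.Cruxes.CylinderRungTwo.KillingFlux

open Literature.Geometry.Riemannian Literature.Geometry.Riemannian.EuclideanHypersurface
open Literature.Geometry.Lorentzian Literature.Geometry.Lorentzian.PseudoRiemannianMetric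
open Literature.Analysis.Calculus
open Literature.Geometry.Riemannian.SphericalCylinderEntropy (cylKernel cylDensity cylEntropy truncL)

section Final

open Literature.Geometry.Riemannian.SphericalCylinderEntropy (cylKernel cylDensity cylEntropy truncL
  cylDensity_range_lt_top harnackQuadratic_nonneg)
open Literature.Geometry.Manifold.CylinderSlice (padL)

variable {M : Type} [TopologicalSpace M] [ChartedSpace (EuclideanSpace ℝ (Fin 4)) M]
  [IsManifold (𝓡 4) ∞ M] [T2Space M] [CompactSpace M] {F ν : ℝ → M → EuclideanSpace ℝ (Fin 6)} {T : ℝ}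

omit [T2Space M] in
/-- **The Harnack integral over a slice is non-negative** (Hamilton's matrix Harnack inequality for
the typed kernel along `N`, tree `harnackQuadratic_nonneg`, at every point of the embedded slice:
on `range (F t)` the extended normal IS `ν t x`, tangent to `N` at `F t x ∈ N`).
[cite: Hamilton1993Harnack, Main Theorem and Cor. 4.4] -/
theorem IsCylinderMCF.harnackIntegral_nonneg (hF : IsCylinderMCF M F ν T)
    {p : EuclideanSpace ℝ (Fin 6)} (hp : ∑ i : Fin 5, p (Fin.castSucc i) ^ 2 = 1) {t : ℝ} (ht : T ≤ t)
    {τ : ℝ} (hτ : 0 < τ) :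
    0 ≤ ∫ z in Set.range (F t),
        (iteratedFDeriv ℝ 2 (cylKernel p τ) z
            ![Function.extend (F t) (ν t) 0 z, Function.extend (F t) (ν t) 0 z]
          - (∑ i : Fin 5, Function.extend (F t) (ν t) 0 z (Fin.castSucc i) ^ 2) *
              fderiv ℝ (cylKernel p τ) z (padL (truncL z))
          - (fderiv ℝ (cylKernel p τ) z (Function.extend (F t) (ν t) 0 z)) ^ 2 / cylKernel p τ z
          + cylKernel p τ z * ‖Function.extend (F t) (ν t) 0 z‖ ^ 2 / (2 * τ)) ∂μH[4] := by
  have hcont : Continuous (F t) := (hF.isSmoothEmbedding t ht).contMDiff.continuous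
  have hinj : Function.Injective (F t) := hF.injective ht
  have hmeas : MeasurableSet (Set.range (F t)) := (isCompact_range hcont).isClosed.measurableSet
  refine setIntegral_nonneg hmeas fun z hz => ?_
  obtain ⟨x, rfl⟩ := hz
  rw [hinj.extend_apply]
  exact harnackQuadratic_nonneg p hp hτ (F t x) (hF.mem_cyl t ht x) (ν t x) (hF.normal_tangent t ht x)

/-- **Hamilton's monotonicity of the typed density along a smooth cylinder flow** (the registered
statement, from the monotonicity formula): with `t₀ = s + σ + τ`, `Z(t) = F̂_{p,t₀-t}(F_t(M))` is
continuous on `[s, s + σ]` (`continuousWithinAt_cylDensity` at `t = T`, differentiability inside)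
and `Z' = -D - c∫Q ≤ 0` on `(s, s + σ)` (`hasDerivAt_cylDensity` and the matrix Harnack
inequality `harnackIntegral_nonneg`), so `Z(s + σ) ≤ Z(s)` (`antitoneOn_of_hasDerivWithinAt_nonpos`),
i.e. `F̂_{p,τ}(F_{s+σ}(M)) ≤ F̂_{p,τ+σ}(F_s(M))` in `ℝ≥0∞` (the densities of compact embedded slices
are finite, `cylDensity_range_lt_top`). [cite: Hamilton1993, Thm. 4.1] -/
theorem IsCylinderMCF.cylDensity_le (hF : IsCylinderMCF M F ν T)
    {p : EuclideanSpace ℝ (Fin 6)} (hp : ∑ i : Fin 5, p (Fin.castSucc i) ^ 2 = 1)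
    {s σ τ : ℝ} (hs : T ≤ s) (hσ : 0 ≤ σ) (hτ : 0 < τ) :
    cylDensity (Set.range (F (s + σ))) p τ ≤ cylDensity (Set.range (F s)) p (τ + σ) := by
  have hfin : ∀ t, T ≤ t → ∀ τ' : ℝ, 0 < τ' → cylDensity (Set.range (F t)) p τ' ≠ ⊤ := fun t ht τ' hτ' =>
    (cylDensity_range_lt_top (hF.isSpacelikeImmersion t ht) (hF.injective ht) (hF.mem_cyl t ht) hp hτ').ne
  set t₀ : ℝ := s + σ + τ with ht₀
  have hTt₀ : T < t₀ := by rw [ht₀]; linarith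
  set Z : ℝ → ℝ := fun t => (cylDensity (Set.range (F t)) p (t₀ - t)).toReal with hZ
  -- derivative data on the interior `(s, s + σ)`
  have hderiv : ∀ t ∈ Set.Ioo s (s + σ), ∃ D' ≤ (0 : ℝ), HasDerivAt Z D' t := by
    intro t ht
    have hTt : T < t := lt_of_le_of_lt hs ht.1
    have htt₀ : t < t₀ := by rw [ht₀]; linarith [ht.2]
    obtain ⟨D, hD, hd⟩ := hF.hasDerivAt_cylDensity hp hTt htt₀
    refine ⟨_, ?_, hd⟩
    have hc : 0 ≤ ((μH[4] (Metric.sphere (0 : EuclideanSpace ℝ (Fin 5)) 1))⁻¹).toReal :=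
      ENNReal.toReal_nonneg
    have hint := hF.harnackIntegral_nonneg hp hTt.le (sub_pos.2 htt₀)
    nlinarith [mul_nonneg hc hint]
  -- continuity on `[s, s + σ]`
  have hcont : ContinuousOn Z (Set.Icc s (s + σ)) := by
    intro t ht
    rcases eq_or_lt_of_le (hs.trans ht.1) with hTt | hTt
    · -- `t = T = s`: right-continuity at `T`
      rw [← hTt]
      exact (hF.continuousWithinAt_cylDensity hp hTt₀).mono fun u hu => hs.trans hu.1
    · have htt₀ : t < t₀ := by rw [ht₀]; linarith [ht.2]
      obtain ⟨D, -, hd⟩ := hF.hasDerivAt_cylDensity hp hTt htt₀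
      exact hd.continuousAt.continuousWithinAt
  classical
  set D' : ℝ → ℝ := fun t => if ht : t ∈ Set.Ioo s (s + σ) then (hderiv t ht).choose else 0 with hD'
  have hanti : AntitoneOn Z (Set.Icc s (s + σ)) := by
    refine antitoneOn_of_hasDerivWithinAt_nonpos (convex_Icc s (s + σ)) hcont (f' := D')
      (fun t ht => ?_) (fun t ht => ?_)
    · rw [interior_Icc] at ht ⊢
      obtain ⟨-, hd⟩ := (hderiv t ht).choose_spec
      have hDt : D' t = (hderiv t ht).choose := by simp only [hD', dif_pos ht]
      rw [hDt]
      exact hd.hasDerivWithinAt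
    · rw [interior_Icc] at ht
      obtain ⟨hle, -⟩ := (hderiv t ht).choose_spec
      have hDt : D' t = (hderiv t ht).choose := by simp only [hD', dif_pos ht]
      rw [hDt]
      exact hle
  have hsσ : s ≤ s + σ := by linarith
  have hZle : Z (s + σ) ≤ Z s :=
    hanti (Set.left_mem_Icc.2 hsσ) (Set.right_mem_Icc.2 hsσ) hsσ
  have h1 : t₀ - (s + σ) = τ := by rw [ht₀]; ring
  have h2 : t₀ - s = τ + σ := by rw [ht₀]; ring
  simp only [hZ, h1, h2] at hZle
  exact (ENNReal.toReal_le_toReal (hfin (s + σ) (by linarith) τ hτ)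
    (hfin s hs (τ + σ) (by linarith))).1 hZle

end Final

/-- **Registered stub `stub_hamiltonMonotonicity` (line `killing-flux`, crux
`CylinderEntropy.CylinderRungTwo`, stmt-SmoothPoincare4-7631): HAMILTON'S MONOTONICITY of the typed
slice-normalised Gaussian density in `N = S⁴ × ℝ`.** Along a smooth mean curvature flow
`IsCylinderMCF M F ν T` of closed embedded cross-sections of `N`, for every centre `p ∈ N`, every
scale `τ > 0`, every lag `σ ≥ 0` and every time `s ≥ T`:
`F̂_{p,τ}(F_{s+σ}(M)) ≤ F̂_{p,τ+σ}(F_s(M))` — Hamilton's theorem (Comm. Anal. Geom. 1 (1993) 127–137,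
Thm. 4.1, hypersurface case `n - m = 1`) for the typed density
`cylDensity (range (F t)) p (t₀ - t) = (4π)^{1/2} · (t₀-t)^{1/2} ∫_{Σ_t} K_N(·, p; t₀ - t) dμ`
(`K_N = H_{S⁴} ⊗ G_ℝ` the heat kernel of `N`), whose time derivative is
`-∫ k|H + ∇^⊥ log k|² - ∫ (Hess_N k(ν,ν) - (∂_ν k)²/k + k/(2(t₀-t))) ≤ 0` by the transport formula
along the flow (part 1), the Green identity on the slice (parts 2–3), the backward heat equation of
the typed kernel (`cylKernel_backward_heat`) and Hamilton's matrix Harnack inequality for the heat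
kernel of `S⁴` transported to the typed kernel (`harnackQuadratic_nonneg`).
[cite: Hamilton1993, Thm. 4.1] -/
theorem stub_hamiltonMonotonicity :
    ∀ (M : Type) [TopologicalSpace M] [T2Space M] [SecondCountableTopology M]
      [ChartedSpace (EuclideanSpace ℝ (Fin 4)) M] [IsManifold (𝓡 4) ∞ M] [CompactSpace M]
      (F : ℝ → M → EuclideanSpace ℝ (Fin 6)) (ν : ℝ → M → EuclideanSpace ℝ (Fin 6)) (T : ℝ),
      IsCylinderMCF M F ν T →
      ∀ p : EuclideanSpace ℝ (Fin 6), ∑ i : Fin 5, p (Fin.castSucc i) ^ 2 = 1 →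
      ∀ s σ τ : ℝ, T ≤ s → 0 ≤ σ → 0 < τ →
        cylDensity (Set.range (F (s + σ))) p τ ≤ cylDensity (Set.range (F s)) p (τ + σ) :=
  fun _ _ _ _ _ _ _ _ _ _ hF _ hp _ _ _ hs hσ hτ => hF.cylDensity_le hp hs hσ hτ

end Summit.SmoothPoincare4.SmoothPoincare4.Cruxes.CylinderRungTwo.KillingFlux

end
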